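import Mathlib
import HarnessLib
import Literature.MathematicalPhysics.StatisticalMechanics.TorusMultiplierKernels

/-!
# The multipliers `m_k(p)` of the higher-derivative operators and their bounds
# (Adams–Buchholz–Kotecký–Müller, (7.32), (7.34), (7.38); the input of Lemma 7.3)

The operator `M_k = Σ_{1≤|α|≤M} L^{2k(|α|−1)} (∇^*)^α∇^α` of [ABKM19] (7.3) has the Fourier multiplier
((7.32)) `m_k(p) = Σ_α L^{2k(|α|−1)} |q(p)^α|²` (`HigherDerivativeForms.dotProduct_derivForm_one_eq_mulMat`).
This file records `derivMul L k s` for an index set `s` of multi-indices and proves the elementary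
bounds on it that enter the scalar Lemma 7.3 (`WeightDominatingStep.step_high/step_low`):

* `derivMul_nonneg`, `derivMul_neg` (even), `derivMul_zero` (vanishes on the zero mode),
  `qnormSq_le_derivMul` (`|q|² ≤ m_k` when `s` contains the unit indices), hence `derivMul_pos` off
  the zero mode and the lower bound `(4/π²)|p|² ≤ m_k` ((7.38), `ω₂`);
* `derivMul_mono` — `m_k ≤ m_{k+1}` for `L ≥ 1` ("the trivial estimate", proof of Lemma 7.3);
* `derivMul_le_of_momNorm_le` — `m_k(p) ≤ (Σ_{α∈s} (L^k ρ)^{2(|α|−1)}) |p|²` for `|p| ≤ ρ`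
  ((7.38): with `ρ = L^{−k+k₀}` the constant is `Σ_α L^{2k₀(|α|−1)}`, uniform in `k`);
* `tail_le_inv_symbR` — for non-negative multipliers `c_j` whose total inverts the symbol
  (`(Σ_j c_j)·â = 1`, `TorusMultiplierKernels.sum_re_fourierCoeff_mul_symbR_eq_one`) every partial
  sum is `≤ â⁻¹ ≤ (ω₀ |q|²)⁻¹` ((7.37) upper bound, `Ω₁`).

Everything is proved; no named fact.  What is NOT here: (7.34) (`4m_k ≤ m_{k+1}` for `|p| ≥ L^{−k}`),
the shell-bound estimates (7.35), (7.37) (lower) which use `GradientFRD.TorusFRD` (v).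

## References
* S. Adams, S. Buchholz, R. Kotecký, S. Müller, arXiv:1910.13564, (7.32)–(7.38) [AdamsBuchholzKoteckyMuller2019].
-/

noncomputable section

namespace Literature.MathematicalPhysics.StatisticalMechanics.GradientRG

open Finset Real
open Literature.MathematicalPhysics.StatisticalMechanics.GradientFRD
  (qmode qpow qnormSq momNorm symbR IsElliptic qmode_neg qmode_zero qnormSq_bounds qnormSq_pos
    norm_qpow_le momNorm_nonneg symbR_bounds)

variable {d M : ℕ} [NeZero M]

/-- **`m_k(κ) = Σ_{α∈s} L^{2k(|α|−1)} |q(κ)^α|²`** — the multiplier of `Σ_{α∈s} L^{2k(|α|−1)}(∇^α)^*∇^α`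
([ABKM19] (7.32)). [cite: AdamsBuchholzKoteckyMuller2019, Remark 7.4 (7.32)] -/
def derivMul (L : ℝ) (k : ℕ) (s : Finset (Fin d → ℕ)) (κ : Fin d → ZMod M) : ℝ :=
  ∑ α ∈ s, L ^ (2 * k * (∑ i, α i - 1)) * ‖qpow α κ‖ ^ 2

/-- `m_k ≥ 0` for `L ≥ 0`. [cite: AdamsBuchholzKoteckyMuller2019, Remark 7.4 (7.32)] -/
theorem derivMul_nonneg {L : ℝ} (hL : 0 ≤ L) (k : ℕ) (s : Finset (Fin d → ℕ)) (κ : Fin d → ZMod M) :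
    0 ≤ derivMul L k s κ :=
  sum_nonneg fun _ _ => mul_nonneg (pow_nonneg hL _) (sq_nonneg _)

/-- `|q(−κ)^α| = |q(κ)^α|`. [cite: Buchholz2016, §2 (2.18)] -/
theorem norm_qpow_neg (α : Fin d → ℕ) (κ : Fin d → ZMod M) : ‖qpow α (-κ)‖ = ‖qpow α κ‖ := by
  unfold qpow
  rw [norm_prod, norm_prod]
  exact prod_congr rfl fun i _ => by rw [norm_pow, norm_pow, qmode_neg, Complex.norm_conj]

/-- `m_k` is even. [cite: AdamsBuchholzKoteckyMuller2019, Remark 7.4 (7.32)] -/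
theorem derivMul_neg (L : ℝ) (k : ℕ) (s : Finset (Fin d → ℕ)) (κ : Fin d → ZMod M) :
    derivMul L k s (-κ) = derivMul L k s κ := by
  unfold derivMul
  exact sum_congr rfl fun α _ => by rw [norm_qpow_neg]

/-- `q(0)^α = 0` for `|α| ≥ 1`. [cite: Buchholz2016, §2 (2.18)] -/
theorem qpow_zero_of_pos {α : Fin d → ℕ} (hα : 1 ≤ ∑ i, α i) : qpow α (0 : Fin d → ZMod M) = 0 := by
  obtain ⟨i, -, hi⟩ : ∃ i ∈ Finset.univ, α i ≠ 0 := by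
    by_contra h
    push Not at h
    have : ∑ i, α i = 0 := sum_eq_zero fun i hi => h i hi
    omega
  unfold qpow
  exact prod_eq_zero (mem_univ i) (by rw [qmode_zero, zero_pow hi])

/-- **`m_k(0) = 0`** when every index in `s` has positive order (the operators kill constants).
[cite: AdamsBuchholzKoteckyMuller2019, Ch. 7.2 (extension by zero)] -/
theorem derivMul_zero (L : ℝ) (k : ℕ) {s : Finset (Fin d → ℕ)} (hs : ∀ α ∈ s, 1 ≤ ∑ i, α i) :
    derivMul L k s (0 : Fin d → ZMod M) = 0 :=
  sum_eq_zero fun α hα => by rw [qpow_zero_of_pos (hs α hα), norm_zero]; ring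

/-- `|q^{e_i}| = |q_i|`. [cite: Buchholz2016, §2 (2.18)] -/
theorem norm_qpow_single (i : Fin d) (κ : Fin d → ZMod M) :
    ‖qpow (Pi.single i 1) κ‖ = ‖qmode κ i‖ := by
  unfold qpow
  rw [norm_prod, prod_eq_single i (fun j _ hj => by rw [Pi.single_eq_of_ne hj, pow_zero, norm_one])
    (fun h => (h (mem_univ i)).elim), Pi.single_eq_same, pow_one]

/-- **`|q|² ≤ m_k`** when `s` contains the unit multi-indices and `L ≥ 0`.
[cite: AdamsBuchholzKoteckyMuller2019, Lemma 7.3 (7.38)] -/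
theorem qnormSq_le_derivMul {L : ℝ} (hL : 0 ≤ L) (k : ℕ) {s : Finset (Fin d → ℕ)}
    (hs : ∀ i : Fin d, (Pi.single i 1 : Fin d → ℕ) ∈ s) (κ : Fin d → ZMod M) :
    qnormSq κ ≤ derivMul L k s κ := by
  classical
  have hinj : Set.InjOn (fun i : Fin d => (Pi.single i 1 : Fin d → ℕ)) ↑(Finset.univ : Finset (Fin d)) :=
    fun i _ j _ h => by
      by_contra hij
      have := congrFun h i
      simp only [Pi.single_eq_same, Pi.single_apply, if_neg hij] at this
      exact one_ne_zero this
  calc qnormSq κ = ∑ i, L ^ (2 * k * (∑ j, (Pi.single i 1 : Fin d → ℕ) j - 1)) *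
        ‖qpow (Pi.single i 1) κ‖ ^ 2 := by
        unfold qnormSq
        refine sum_congr rfl fun i _ => ?_
        rw [norm_qpow_single, Finset.sum_pi_single']
        simp
    _ = ∑ α ∈ Finset.univ.image (fun i : Fin d => (Pi.single i 1 : Fin d → ℕ)),
          L ^ (2 * k * (∑ j, α j - 1)) * ‖qpow α κ‖ ^ 2 := by
        rw [sum_image hinj]
    _ ≤ derivMul L k s κ := by
        unfold derivMul
        refine sum_le_sum_of_subset_of_nonneg (fun α hα => ?_) fun α _ _ =>
          mul_nonneg (pow_nonneg hL _) (sq_nonneg _)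
        obtain ⟨i, -, rfl⟩ := mem_image.1 hα
        exact hs i

/-- **`m_k > 0` off the zero mode** (so `λ m_k⁻¹` is finite and positive there).
[cite: AdamsBuchholzKoteckyMuller2019, Lemma 7.3 (7.38)] -/
theorem derivMul_pos {L : ℝ} (hL : 0 ≤ L) (k : ℕ) {s : Finset (Fin d → ℕ)}
    (hs : ∀ i : Fin d, (Pi.single i 1 : Fin d → ℕ) ∈ s) {κ : Fin d → ZMod M} (hκ : κ ≠ 0) :
    0 < derivMul L k s κ :=
  lt_of_lt_of_le (qnormSq_pos hκ) (qnormSq_le_derivMul hL k hs κ)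

/-- **Lower bound `(4/π²)|p|² ≤ m_k`** ((7.38), the constant `ω₂`).
[cite: AdamsBuchholzKoteckyMuller2019, Lemma 7.3 (7.38)] -/
theorem momNorm_sq_le_derivMul {L : ℝ} (hL : 0 ≤ L) (k : ℕ) {s : Finset (Fin d → ℕ)}
    (hs : ∀ i : Fin d, (Pi.single i 1 : Fin d → ℕ) ∈ s) (κ : Fin d → ZMod M) :
    4 / π ^ 2 * momNorm κ ^ 2 ≤ derivMul L k s κ :=
  (qnormSq_bounds κ).1.trans (qnormSq_le_derivMul hL k hs κ)

/-- **`m_k ≤ m_{k+1}`** for `L ≥ 1` ("the trivial estimate `M_k ≤ M_{k+1}`", proof of Lemma 7.3).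
[cite: AdamsBuchholzKoteckyMuller2019, Lemma 7.3 (proof, after (7.38))] -/
theorem derivMul_mono {L : ℝ} (hL : 1 ≤ L) {k k' : ℕ} (hkk' : k ≤ k') (s : Finset (Fin d → ℕ))
    (κ : Fin d → ZMod M) : derivMul L k s κ ≤ derivMul L k' s κ :=
  sum_le_sum fun _ _ => mul_le_mul_of_nonneg_right
    (pow_le_pow_right₀ hL (Nat.mul_le_mul_right _ (Nat.mul_le_mul_left 2 hkk'))) (sq_nonneg _)

/-- **Upper bound at small momenta** ((7.38)): if `|p(κ)| ≤ ρ` (`L ≥ 0`) and every index in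
`s` has positive order, then `m_k(κ) ≤ (Σ_{α∈s} (L^k ρ)^{2(|α|−1)}) · |p(κ)|²`.
[cite: AdamsBuchholzKoteckyMuller2019, Lemma 7.3 (7.38)] -/
theorem derivMul_le_of_momNorm_le {L ρ : ℝ} (hL : 0 ≤ L) (k : ℕ) {s : Finset (Fin d → ℕ)}
    (hs : ∀ α ∈ s, 1 ≤ ∑ i, α i) {κ : Fin d → ZMod M} (hκ : momNorm κ ≤ ρ) :
    derivMul L k s κ ≤ (∑ α ∈ s, (L ^ k * ρ) ^ (2 * (∑ i, α i - 1))) * momNorm κ ^ 2 := by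
  rw [derivMul, sum_mul]
  refine sum_le_sum fun α hα => ?_
  have hp := momNorm_nonneg κ
  have h1 : ‖qpow α κ‖ ^ 2 ≤ momNorm κ ^ (2 * (∑ i, α i - 1)) * momNorm κ ^ 2 := by
    calc ‖qpow α κ‖ ^ 2 ≤ (momNorm κ ^ ∑ i, α i) ^ 2 :=
          pow_le_pow_left₀ (norm_nonneg _) (norm_qpow_le α κ) 2
      _ = momNorm κ ^ (2 * (∑ i, α i - 1)) * momNorm κ ^ 2 := by
          rw [← pow_mul, ← pow_add]; congr 1; have := hs α hα; omega
  have h2 : momNorm κ ^ (2 * (∑ i, α i - 1)) ≤ ρ ^ (2 * (∑ i, α i - 1)) :=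
    pow_le_pow_left₀ hp hκ _
  calc L ^ (2 * k * (∑ i, α i - 1)) * ‖qpow α κ‖ ^ 2
      ≤ L ^ (2 * k * (∑ i, α i - 1)) * (ρ ^ (2 * (∑ i, α i - 1)) * momNorm κ ^ 2) :=
        mul_le_mul_of_nonneg_left (h1.trans (mul_le_mul_of_nonneg_right h2 (sq_nonneg _)))
          (pow_nonneg hL _)
    _ = (L ^ k * ρ) ^ (2 * (∑ i, α i - 1)) * momNorm κ ^ 2 := by
        rw [mul_pow, ← pow_mul]; ring_nf

/-- **The tails of the covariance multipliers are bounded by the inverse symbol** ((7.37), `Ω₁`):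
if `c_j ≥ 0` and `(Σ_{j∈s} c_j)·â = 1`, then `Σ_{j∈s'} c_j ≤ â⁻¹` for every `s' ⊆ s`.
[cite: AdamsBuchholzKoteckyMuller2019, Lemma 7.3 (7.37)] -/
theorem tail_le_inv_symb {ι : Type*} {s s' : Finset ι} (hs' : s' ⊆ s) {c : ι → ℝ} {a : ℝ}
    (hc : ∀ j ∈ s, 0 ≤ c j) (hinv : (∑ j ∈ s, c j) * a = 1) :
    ∑ j ∈ s', c j ≤ a⁻¹ := by
  have h1 : ∑ j ∈ s', c j ≤ ∑ j ∈ s, c j := sum_le_sum_of_subset_of_nonneg hs' fun j hj _ => hc j hj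
  have h2 : ∑ j ∈ s, c j = a⁻¹ := eq_inv_of_mul_eq_one_left hinv
  linarith

/-- … and `â⁻¹ ≤ (ω₀ · (4/π²) |p|²)⁻¹` for an elliptic symbol off the zero mode ((7.37): `t ≤ Ω₁|p|^{−2}`).
[cite: AdamsBuchholzKoteckyMuller2019, Lemma 7.3 (7.37)] -/
theorem inv_symbR_le {ω₀ Ω₀ : ℝ} {A : Matrix (Fin d) (Fin d) ℝ} (hA : IsElliptic ω₀ Ω₀ A) (hω : 0 < ω₀)
    {κ : Fin d → ZMod M} (hκ : κ ≠ 0) :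
    (symbR A κ)⁻¹ ≤ (ω₀ * (4 / π ^ 2 * momNorm κ ^ 2))⁻¹ := by
  have hq := qnormSq_pos hκ
  have h1 : ω₀ * (4 / π ^ 2 * momNorm κ ^ 2) ≤ symbR A κ :=
    (mul_le_mul_of_nonneg_left (qnormSq_bounds κ).1 hω.le).trans (symbR_bounds hA κ).1
  have h0 : 0 < ω₀ * (4 / π ^ 2 * momNorm κ ^ 2) := by
    have : 0 < momNorm κ ^ 2 := by
      have hb := (qnormSq_bounds κ).2
      nlinarith
    positivity
  exact inv_anti₀ h0 h1

end Literature.MathematicalPhysics.StatisticalMechanics.GradientRG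

end
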